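import Mathlib
import Literature.Computability.Complexity.AlgebraicPCPSoundness
import Literature.Computability.Complexity.TableauCSP
import Literature.Computability.Complexity.PCPCoins
import Literature.Computability.Complexity.PCP
import HarnessLib

/-!
# The scaled-up PCP verifier of an exponential-time computation (BFL / BFLS): specification, completeness, soundness

Literature / complexity toolkit. For a FIXED multi-stack machine `M` with a time bound `T n` on the
inputs `⟨x, ε⟩`, `|x| = n` (the shape in which a decider of a language of `E` enters the Cook–Levin
tableau of `CookLevinTableau.lean` with no certificate), this file SPECIFIES the nonadaptive PCP
verifier of Babai–Fortnow–Lund 1991 / Babai–Fortnow–Levin–Szegedy 1991 (Arora–Barak 2009, §11.5,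
§8.6) as a `PCPVerifier` of `PCP.lean` — coin budget, query map, decision map, as MATHEMATICAL maps
(their polynomial running time is the business of `ScaledPCPVerifierFP.lean`) — by assembling

* the arithmetized tableau `TableauCSP.tableauCSP` (an algebraic CSP over `Hᵐ`, `H = {0,…,h-1}`,
  satisfiable iff the run accepts, `satisfiable_tableauCSP_iff_exists`),
* the oracle proof system `AlgebraicPCP` (proof = oracle `Y : 𝔽ᵐ → 𝔽` + sumcheck messages; its
  `completeness` and `soundness` over `𝔽 = ZMod p`),
* the coin decoding `PCPCoins` (uniform bits → uniform tape, accept on a bad block),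

with explicit parameters polynomial in `n` (`Params`: `h = (n+2)²`, digits, `m`, `K`, `d = m(h-1)`,
`D`, the number of low-degree tests, the prime `p` — the least prime above `16 (K D + K h + N + d)`,
Bertrand), a proof CODE (`proofOf π`: the oracle values and message coefficients are read off blocks
of `⌈log₂ p⌉ + 1` proof bits at explicit positions of `O(n)` bits, `posY`, `posS`), and proves

* `accepts_iff` — the verifier accepts `x` with proof `π` on coins `ρ` iff the coins are bad or the
  algebraic verifier accepts the decoded proof on the decoded tape;
* **`completeness`** — if the run of `M` on `⟨x, ε⟩` accepts, the coded honest proof is accepted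
  with probability `1`;
* **`soundness`** — if it rejects, every proof is accepted with probability `≤ 1/2`.

(The bound `queries < 2^{c n + c}` on the positions and the running time of the two maps are the
business of the sequels.)

Relation to `AlgebraicPCPLayout.lean` (a parallel bit layout `PCPBits.*` of the same proof system,
landed while this file was in preparation): the layouts differ in inessential conventions (this file
accepts on a badly decoded coin block so that the decoded tape is EXACTLY uniform, `PCPCoins.lean`;
`PCPBits` reduces every block modulo `p`); what this file adds is the CHOICE OF PARAMETERS as
functions of `n` and the end-to-end probability statements for the tableau CSP of a machine — the
arithmetic `((M² - θ)/M²)^T ≤ 1/7`, `2 |Qry| (d+1) θ / M² ≤ 1/8`, `(K D + K(h-1) + N - 1)/p ≤ 1/16`,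
`kF p / 2^b ≤ 1/16` — which transfer verbatim to either layout.

## References

* L. Babai, L. Fortnow, C. Lund, Comput. Complexity 1 (1991), §4–§7 [BabaiFortnowLund1991].
* L. Babai, L. Fortnow, L. Levin, M. Szegedy, STOC 1991, §5 [BFLS1991].
* S. Arora, B. Barak, *Computational Complexity: A Modern Approach*, CUP 2009, §11.5, §8.6,
  Def. 11.4 [AroraBarakCC2009].
-/

noncomputable section

open Finset Polynomial

namespace Literature.Computability.Complexity

/-! ### Acceptance depends only on the values read -/

namespace AlgebraicPCP

open LowDegreeExtension LowDegreeTest SumcheckF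

variable {F : Type} [Field F] [DecidableEq F] {K m : ℕ} (H : Finset F) (prm : Params) (C : CSP F K m)

/-- The oracle points of the low-degree tests of a tape. [folklore] -/
def ldtPts (τ : Tape F C prm.T) : Finset (Fin m → F) :=
  univ.biUnion fun i : Fin prm.T => (range (prm.d + 2)).image fun j : ℕ => (τ.tests i).1 + (j : F) • (τ.tests i).2

/-- The oracle points of the self-corrected reads of a tape. [folklore] -/
def scPts (τ : Tape F C prm.T) : Finset (Fin m → F) :=
  univ.biUnion fun q : C.Qry => univ.image fun i : Fin (prm.d + 1) => readAddr ((C.fam q.1).addr q.2) τ.r + scNode (F := F) prm.d i • τ.dirs q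

/-- **Acceptance depends only on the oracle at the test / read points and on the `K` messages along
the actual challenges.** [folklore] -/
theorem accept_congr {π π' : Proof F K m C.N} {τ : Tape F C prm.T}
    (hY : ∀ w ∈ ldtPts prm C τ ∪ scPts prm C τ, π.Y w = π'.Y w)
    (hS : ∀ i, i < K → π.S τ.ρ τ.seed ((List.ofFn τ.r).take i) = π'.S τ.ρ τ.seed ((List.ofFn τ.r).take i)) :
    Accept H prm C π τ ↔ Accept H prm C π' τ := by
  have hldt : ∀ i, testSum (diffCoeff prm.d) prm.d π.Y (τ.tests i).1 (τ.tests i).2 =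
      testSum (diffCoeff prm.d) prm.d π'.Y (τ.tests i).1 (τ.tests i).2 := by
    intro i
    unfold testSum
    refine sum_congr rfl fun j hj => ?_
    rw [hY _ (mem_union_left _ (mem_biUnion.2 ⟨i, mem_univ _, mem_image.2 ⟨j, hj, rfl⟩⟩))]
  have hsc : ∀ q, scVal prm C π τ q = scVal prm C π' τ q := by
    intro q
    unfold scVal selfCorrect LineCorrect.correctVal
    congr 2
    funext i
    exact hY _ (mem_union_right _ (mem_biUnion.2 ⟨q, mem_univ _, mem_image.2 ⟨i, mem_univ _, rfl⟩⟩))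
  have hfin : finalVal H prm C π τ = finalVal H prm C π' τ := by
    unfold finalVal
    have hfun : (fun φ : Fin C.N => τ.lam φ * (C.fam φ).value τ.r fun j => scVal prm C π τ ⟨φ, j⟩) =
        fun φ => τ.lam φ * (C.fam φ).value τ.r fun j => scVal prm C π' τ ⟨φ, j⟩ := by
      funext φ
      simp only [hsc]
    rw [hfun]
  have hmsg : ∀ i, i < K → msgs prm C π τ i = msgs prm C π' τ i := fun i hi => hS i hi
  have hchain : ∀ i, i ≤ K → chain 0 (msgs prm C π τ) (List.ofFn τ.r) i = chain 0 (msgs prm C π' τ) (List.ofFn τ.r) i := by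
    intro i hi
    rcases i with _ | i
    · rfl
    · simp only [chain]
      rw [hmsg i (by omega)]
  constructor
  · intro h
    refine ⟨⟨fun i => ?_⟩, ⟨fun i hi => ?_, ?_⟩⟩
    · rw [← hldt]; exact h.rs.test i
    · rw [← hmsg i hi, ← hchain i hi.le]; exact h.sum.round i hi
    · rw [← hfin, ← hchain K le_rfl]; exact h.sum.final
  · intro h
    refine ⟨⟨fun i => ?_⟩, ⟨fun i hi => ?_, ?_⟩⟩
    · rw [hldt]; exact h.rs.test i
    · rw [hmsg i hi, hchain i hi.le]; exact h.sum.round i hi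
    · rw [hfin, hchain K le_rfl]; exact h.sum.final

/-! ### The honest proof, explicitly -/

/-- The low-degree extension of a table is a polynomial of degree `≤ d` on every line when
`m (#H - 1) ≤ d`. [folklore] -/
theorem linePoly_lde (Y₀ : (Fin m → F) → F) (hd : m * (H.card - 1) ≤ prm.d) : LinePoly (lde H Y₀) prm.d := by
  have h := linePoly_eval_mvPolynomial (ldePoly H Y₀)
  have hfun : (fun z => MvPolynomial.eval z (ldePoly H Y₀)) = lde H Y₀ := funext (eval_ldePoly Y₀)
  rw [hfun] at h
  exact h.mono ((totalDegree_ldePoly_le Y₀).trans hd)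

/-- **The honest proof** of a table `Y₀`: its low-degree extension and the honest sumcheck messages
(round polynomials) for every `(ρ, λ, prefix)`. [cite: BabaiFortnowLund1991, §5] -/
def honestProof (Y₀ : (Fin m → F) → F) (hd : m * (H.card - 1) ≤ prm.d) (hd1 : 1 ≤ prm.d)
    (hD : C.maxDeg * prm.d + (H.card - 1) ≤ prm.D) : Proof F K m C.N :=
  ⟨lde H Y₀, fun ρ seed pref =>
    roundPoly H ((axisPoly_Φ (C := C) (H := H) (linePoly_lde H prm Y₀ hd) hd1 ρ fun φ => seed ^ (φ : ℕ)).mono hD) pref⟩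

/-- The honest messages have degree `≤ D`. [folklore] -/
theorem natDegree_honestProof_le (Y₀ : (Fin m → F) → F) (hd : m * (H.card - 1) ≤ prm.d) (hd1 : 1 ≤ prm.d)
    (hD : C.maxDeg * prm.d + (H.card - 1) ≤ prm.D) (ρ : Fin K → F) (seed : F) (pref : List F) :
    ((honestProof H prm C Y₀ hd hd1 hD).S ρ seed pref).natDegree ≤ prm.D := by
  unfold honestProof
  dsimp only
  exact natDegree_roundPoly_le _ _

/-- **The honest proof of a satisfying table is accepted on every tape** (the proof of
`completeness`, for the explicit proof). [cite: BabaiFortnowLund1991, §5 (completeness)] -/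
theorem accept_honestProof (hWF : C.WF H) {Y₀ : (Fin m → F) → F} (hsat : C.Satisfies H Y₀)
    (hd : m * (H.card - 1) ≤ prm.d) (hd1 : 1 ≤ prm.d) (hD : C.maxDeg * prm.d + (H.card - 1) ≤ prm.D)
    (hunit : ∀ i : ℕ, 1 ≤ i → i ≤ prm.d → (i : F) ≠ 0) (τ : Tape F C prm.T) :
    Accept H prm C (honestProof H prm C Y₀ hd hd1 hD) τ := by
  classical
  have hline : LinePoly (lde H Y₀) prm.d := linePoly_lde H prm Y₀ hd
  have hΦ : ∀ (ρ : Fin K → F) (lam : Fin C.N → F), AxisPoly (Φ H C (lde H Y₀) ρ lam) K prm.D :=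
    fun ρ lam => (axisPoly_Φ hline hd1 ρ lam).mono hD
  have hΨ : ∀ (lam : Fin C.N → F) (z : Fin K → F), (∀ t, z t ∈ H) → Ψ C (lde H Y₀) lam z = 0 := by
    intro lam z hz
    unfold Ψ
    refine sum_eq_zero fun φ _ => ?_
    rw [eval_eq_of_agree_on_H (hWF.wf φ) (fun w hw => lde_apply_of_mem Y₀ hw) hz, hsat.eval_eq_zero φ z hz, mul_zero]
  have hpsum : ∀ (ρ : Fin K → F) (lam : Fin C.N → F), psum H (Φ H C (lde H Y₀) ρ lam) K [] = 0 := by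
    intro ρ lam
    rw [psum_Φ, lde_eq_sum_eqPoly]
    exact sum_eq_zero fun c _ => by rw [hΨ lam _ fun t => (c t).2, zero_mul]
  refine ⟨⟨fun i => ?_⟩, ?_⟩
  · show testSum (diffCoeff prm.d) prm.d (lde H Y₀) (τ.tests i).1 (τ.tests i).2 = 0
    rw [testSum_diffCoeff]
    exact fwdDiff_iter_lde_eq_zero Y₀ hd _ _
  · have hcomp := SumcheckF.completeness (H := H) (hΦ τ.ρ τ.lam) (r := List.ofFn τ.r) (List.length_ofFn)
    rw [hpsum] at hcomp
    have hsc : GoodSC (prm := prm) (honestProof H prm C Y₀ hd hd1 hD) τ (lde H Y₀) :=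
      ⟨fun q => selfCorrect_eq_of_linePoly hunit hline _ _⟩
    refine ⟨fun i hi => ⟨hcomp.deg i hi, hcomp.sum i hi⟩, ?_⟩
    rw [finalVal_eq_Φ hsc]
    exact hcomp.final

end AlgebraicPCP

namespace ScaledPCP

open Turing Tableau TableauCSP DigitPoly AlgebraicPCP LowDegreeTest

variable (M : TM2ComputableAux Bool Bool) (T : ℕ → ℕ)

attribute [local instance] Turing.FinTM2.kFin Turing.FinTM2.ΛFin Turing.FinTM2.σFin
  Turing.FinTM2.Γk₀Fin

/-! ### Parameters -/

/-- The base: `h = 16 n + 8 c_Q + 8` nodes `0, …, h - 1` (`c_Q` the number of reads of the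
`n`-families, `TableauCSP.cQ`, so that `d ≥ h - 1 ≥ 8 ·` the number of reads).
[cite: AroraBarakCC2009, §11.5.2] -/
def hN (n : ℕ) : ℕ := 16 * n + 8 * cQ M + 8

/-- `2 ≤ h`. [folklore] -/
theorem two_le_hN (n : ℕ) : 2 ≤ hN M n := by
  unfold hN; omega

/-- The last block index of a row (no certificate). [folklore] -/
def S1N (n : ℕ) : ℕ := S1 M n 0 (T n)

/-- Row digits: `T n < h^{kt}`. [folklore] -/
def ktN (n : ℕ) : ℕ := Nat.log (hN M n) (T n) + 1

/-- Column digits: `S₁ < h^{kJ}`. [folklore] -/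
def kJN (n : ℕ) : ℕ := Nat.log (hN M n) (S1N M T n) + 1

/-- The layout. [folklore] -/
def LN (n : ℕ) : Layout := ⟨hN M n, ktN M T n, kJN M T n⟩

/-- `T n < h^{kt}`. [folklore] -/
theorem T_lt_pow (n : ℕ) : T n < (LN M T n).h ^ (LN M T n).kt :=
  Nat.lt_pow_succ_log_self (two_le_hN M n) _

/-- `S₁ < h^{kJ}`. [folklore] -/
theorem S1_lt_pow (n : ℕ) : S1 M n 0 (T n) < (LN M T n).h ^ (LN M T n).kJ :=
  Nat.lt_pow_succ_log_self (two_le_hN M n) _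

/-- The dimension of the table: `m = kt + kJ + 1`. [folklore] -/
def mN (n : ℕ) : ℕ := mPt (LN M T n)

/-- The dimension of the constraint index: `K = kt + kt + (2d_M+1) kJ`. [folklore] -/
def KN (n : ℕ) : ℕ := KIdx (LN M T n) (dM M)

/-- The degree of the low-degree extension / test: `d = m (h - 1)`. [cite: AroraBarakCC2009, §11.5.2] -/
def dN (n : ℕ) : ℕ := mN M T n * (hN M n - 1)

/-- The degree bound of the sumcheck messages: `D = degBound · d + (h - 1)`. [folklore] -/
def DN (n : ℕ) : ℕ := degBound M (LN M T n) * dN M T n + (hN M n - 1)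

/-- The number of low-degree tests: `4 (d+1)(2d+5)`. [folklore] -/
def TtN (n : ℕ) : ℕ := 4 * ((dN M T n + 1) * (2 * dN M T n + 5))

/-- The verifier's parameters. [folklore] -/
def prmN (n : ℕ) : Params := ⟨dN M T n, DN M T n, TtN M T n⟩

/-- The degree parameter. [folklore] -/
@[simp] theorem prmN_d (n : ℕ) : (prmN M T n).d = dN M T n := rfl

/-- The message degree parameter. [folklore] -/
@[simp] theorem prmN_D (n : ℕ) : (prmN M T n).D = DN M T n := rfl

/-- The number of tests. [folklore] -/
@[simp] theorem prmN_T (n : ℕ) : (prmN M T n).T = TtN M T n := rfl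

/-- The number of families (computed over `ℚ`; it does not depend on the field, `N_eq`). [folklore] -/
def NN' (n : ℕ) : ℕ := 2 * n + (nFams (F := ℚ) M (LN M T n) n 0 (T n)).length

/-- The bound the prime must exceed: `16 (K D + K (h-1) + N + d + h)`. [folklore] -/
def BN (n : ℕ) : ℕ := 16 * (KN M T n * DN M T n + KN M T n * (hN M n - 1) + NN' M T n + dN M T n + hN M n) + Nat.card (Val M.tm)

/-- There is a prime above the bound. [Mathlib `Nat.exists_infinite_primes`] [folklore] -/
theorem exists_prime_gt (n : ℕ) : ∃ q, BN M T n < q ∧ q.Prime := by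
  obtain ⟨q, hq, hprime⟩ := Nat.exists_infinite_primes (BN M T n + 1)
  exact ⟨q, hq, hprime⟩

open scoped Classical in
/-- **The prime** `p`: the least prime above the bound. [cite: AroraBarakCC2009, §11.5.2] -/
def pN (n : ℕ) : ℕ := Nat.find (exists_prime_gt M T n)

/-- `p` is prime. [folklore] -/
theorem pN_prime (n : ℕ) : (pN M T n).Prime := by
  classical
  exact (Nat.find_spec (exists_prime_gt M T n)).2

/-- `B < p`. [folklore] -/
theorem BN_lt_pN (n : ℕ) : BN M T n < pN M T n := by
  classical
  exact (Nat.find_spec (exists_prime_gt M T n)).1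

/-- `p ≤ 2 B + 2` (Bertrand). [Mathlib `Nat.exists_prime_lt_and_le_two_mul`] [folklore] -/
theorem pN_le (n : ℕ) : pN M T n ≤ 2 * (BN M T n + 1) := by
  classical
  obtain ⟨q, hprime, hlt, hle⟩ := Nat.exists_prime_lt_and_le_two_mul (BN M T n + 1) (by omega)
  exact (Nat.find_min' (exists_prime_gt M T n) ⟨by omega, hprime⟩).trans hle

/-- `p` is prime (instance form). [folklore] -/
instance (n : ℕ) : Fact (pN M T n).Prime := ⟨pN_prime M T n⟩

/-- `p ≠ 0` (instance form). [folklore] -/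
instance (n : ℕ) : NeZero (pN M T n) := ⟨(pN_prime M T n).ne_zero⟩

/-- `2 ≤ p`. [folklore] -/
theorem two_le_pN (n : ℕ) : 2 ≤ pN M T n := (pN_prime M T n).two_le

-- The prime and the digit counts are defined by searches (`Nat.find`, `Nat.log`); keep definitional
-- unfolding (`whnf`) away from them.
attribute [irreducible] pN ktN kJN

/-- The field. [folklore] -/
abbrev FF (n : ℕ) : Type := ZMod (pN M T n)

/-- The field is finite (instance form). [folklore] -/
instance (n : ℕ) : Fintype (FF M T n) := ZMod.fintype _

/-- The node set `H = {0, …, h-1}`. [folklore] -/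
def HN (n : ℕ) : Finset (FF M T n) := nodes (hN M n)

/-! ### The CSP instance -/

/-- **The arithmetized tableau of `M` on `⟨x, ε⟩`** over `ZMod p`, with the parameters of input
length `n` (used with `n = |x|`; the length is a separate argument so that the TYPE of the CSP
depends on `n` only). [cite: BabaiFortnowLund1991, §4] -/
def CN (n : ℕ) (x : List Bool) : CSP (FF M T n) (KN M T n) (mN M T n) :=
  tableauCSP M (LN M T n) 0 (T n) x

/-! ### Splitting and chunking vectors -/

section Vec

variable {F : Type}

/-- Splitting a vector of length `a + b` into its two parts. [folklore] -/
def splitVec (a b : ℕ) : (Fin (a + b) → F) ≃ (Fin a → F) × (Fin b → F) :=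
  (finSumFinEquiv.symm.arrowCongr (Equiv.refl F)).trans (Equiv.sumArrowEquivProdArrow _ _ _)

/-- The first part reads the first `a` coordinates. [folklore] -/
@[simp] theorem splitVec_fst (a b : ℕ) (v : Fin (a + b) → F) (i : Fin a) : (splitVec a b v).1 i = v (Fin.castAdd b i) := by
  simp [splitVec, Equiv.sumArrowEquivProdArrow, Equiv.arrowCongr]

/-- The second part reads the last `b` coordinates. [folklore] -/
@[simp] theorem splitVec_snd (a b : ℕ) (v : Fin (a + b) → F) (j : Fin b) : (splitVec a b v).2 j = v (Fin.natAdd a j) := by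
  simp [splitVec, Equiv.sumArrowEquivProdArrow, Equiv.arrowCongr]

/-- Chunking a vector of length `t * w` into `t` chunks of length `w`. [folklore] -/
def chunkVec (t w : ℕ) : (Fin (t * w) → F) ≃ (Fin t → Fin w → F) :=
  (finProdFinEquiv.symm.arrowCongr (Equiv.refl F)).trans (Equiv.curry _ _ _)

/-- Chunk `i`, coordinate `j` is coordinate `i w + j`. [folklore] -/
theorem chunkVec_apply (t w : ℕ) (v : Fin (t * w) → F) (i : Fin t) (j : Fin w) :
    chunkVec t w v i j = v (finProdFinEquiv (i, j)) := by
  simp [chunkVec, Equiv.arrowCongr, Equiv.curry]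

/-- A vector of length `1` is its value. [folklore] -/
def vecOne : (Fin 1 → F) ≃ F := Equiv.funUnique (Fin 1) F

end Vec

/-! ### Tapes from vectors of field elements -/

section TapeVec

variable {F : Type} [Field F] {K m : ℕ} (C : CSP F K m) (Tt : ℕ)

/-- The number of oracle reads of the final check. [folklore] -/
def nQry : ℕ := ∑ φ : Fin C.N, (C.fam φ).arity

/-- The reads enumerated: `(φ, j) ↦ ∑_{φ' < φ} arity φ' + j`. [Mathlib `finSigmaFinEquiv`] [folklore] -/
def qryEquiv : C.Qry ≃ Fin (nQry C) := finSigmaFinEquiv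

/-- The number of field elements of a tape: `K + 1 + K + Tt (m + m) + Q m`. [folklore] -/
def nTape : ℕ := K + (1 + (K + (Tt * (m + m) + nQry C * m)))

/-- The five blocks of a tape. [folklore] -/
abbrev Blocks : Type :=
  (Fin K → F) × (Fin 1 → F) × (Fin K → F) × (Fin (Tt * (m + m)) → F) × (Fin (nQry C * m) → F)

/-- Cutting a vector into the five blocks. [folklore] -/
def blocksEquiv : (Fin (nTape C Tt) → F) ≃ Blocks C Tt :=
  (splitVec K _).trans ((Equiv.refl _).prodCongr ((splitVec 1 _).trans ((Equiv.refl _).prodCongr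
    ((splitVec K _).trans ((Equiv.refl _).prodCongr (splitVec _ _))))))

/-- The tests block as pairs of points. [folklore] -/
def testsEquiv : (Fin (Tt * (m + m)) → F) ≃ (Fin Tt → (Fin m → F) × (Fin m → F)) :=
  (chunkVec Tt (m + m)).trans (Equiv.arrowCongr (Equiv.refl _) (splitVec m m))

/-- The directions block as a direction per read. [folklore] -/
def dirsEquiv : (Fin (nQry C * m) → F) ≃ (C.Qry → Fin m → F) :=
  (chunkVec (nQry C) m).trans (Equiv.arrowCongr (qryEquiv C).symm (Equiv.refl _))

/-- **Tapes are vectors of `nTape` field elements.** [folklore] -/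
def tapeEquiv : (Fin (nTape C Tt) → F) ≃ Tape F C Tt :=
  (blocksEquiv C Tt).trans
    { toFun := fun b => ⟨b.1, vecOne b.2.1, b.2.2.1, testsEquiv Tt b.2.2.2.1, dirsEquiv C b.2.2.2.2⟩
      invFun := fun τ => (τ.ρ, vecOne.symm τ.seed, τ.r, (testsEquiv Tt).symm τ.tests, (dirsEquiv C).symm τ.dirs)
      left_inv := fun b => by simp
      right_inv := fun τ => by cases τ; simp }

end TapeVec

/-! ### The number of reads depends on the input length only -/

/-- The arities of the bit families sum to `2 |x|`. [folklore] -/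
theorem sum_arity_xFams {F : Type} [Field F] [DecidableEq F] (L : Layout) (x : List Bool) :
    ((xFams (F := F) M L x).map Family.arity).sum = 2 * x.length := by
  have key : ∀ l : List (Bool × ℕ), ((l.flatMap fun p : Bool × ℕ =>
      [unitFam (F := F) M L 0 (2 * p.2 + 1) (symVal M p.1), unitFam M L 0 (2 * p.2 + 2) (symVal M p.1)]).map Family.arity).sum =
        2 * l.length := by
    intro l
    induction l with
    | nil => rfl
    | cons a l ih =>
      rw [List.flatMap_cons, List.map_append, List.sum_append, ih, List.length_cons]
      simp [unitFam]
      ring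
  unfold xFams
  rw [key, List.length_zipIdx]

/-- The number of reads of the tableau CSP. [folklore] -/
theorem nQry_CN (n : ℕ) (x : List Bool) :
    nQry (CN M T n x) = 2 * x.length + ((nFams (F := FF M T n) M (LN M T n) x.length 0 (T n)).map Family.arity).sum := by
  show (∑ φ : Fin (xFams (F := FF M T n) M (LN M T n) x ++ nFams M (LN M T n) x.length 0 (T n)).length,
    ((xFams (F := FF M T n) M (LN M T n) x ++ nFams M (LN M T n) x.length 0 (T n)).get φ).arity) = _
  simp only [List.get_eq_getElem]
  rw [Fin.sum_univ_fun_getElem (xFams (F := FF M T n) M (LN M T n) x ++ nFams M (LN M T n) x.length 0 (T n)) Family.arity,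
    List.map_append, List.sum_append, sum_arity_xFams]

/-- The number of reads depends on `|x|` only. [folklore] -/
theorem nQry_CN_eq {n : ℕ} {x x' : List Bool} (h : x.length = x'.length) : nQry (CN M T n x) = nQry (CN M T n x') := by
  rw [nQry_CN, nQry_CN, h]

/-! ### Coins -/

/-- The number of field elements drawn on inputs of length `n`. [folklore] -/
def kF (n : ℕ) : ℕ := nTape (CN M T n (List.replicate n false)) (TtN M T n)

/-- `kF |x|` is the number of field elements of a tape of the CSP of `x`. [folklore] -/
theorem kF_eq (x : List Bool) : kF M T x.length = nTape (CN M T x.length x) (TtN M T x.length) := by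
  unfold kF nTape
  rw [nQry_CN_eq M T (x := List.replicate x.length false) (x' := x) (by simp)]

-- `kF`, `NN'`, `BN` are symbolic (lengths of the family lists, `Nat.card`): no definitional unfolding.
attribute [irreducible] kF NN' BN

/-- Bits per field element: `⌊log₂ p⌋ + 1 + e` with `2^e ≥ 32 k`. [cite: AroraBarakCC2009, Lemma A.31] -/
def bN (n : ℕ) : ℕ := Nat.log 2 (pN M T n) + 1 + (Nat.log 2 (kF M T n) + 5)

/-- **The coin budget.** [folklore] -/
def coinsN (n : ℕ) : ℕ := kF M T n * bN M T n

/-- `p < 2^{⌊log₂ p⌋ + 1}`. [folklore] -/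
theorem pN_lt_two_pow (n : ℕ) : pN M T n < 2 ^ (Nat.log 2 (pN M T n) + 1) :=
  Nat.lt_pow_succ_log_self (by norm_num) _

/-- The number of field elements of a tape of the CSP of `x` (`= kF |x|`, `kF_eq`). [folklore] -/
abbrev kT (x : List Bool) : ℕ := nTape (CN M T x.length x) (TtN M T x.length)

/-- The decoded tape of a coin string. [cite: AroraBarakCC2009, Lemma A.31] -/
def tapeOf (x ρ : List Bool) : Tape (FF M T x.length) (CN M T x.length x) (TtN M T x.length) :=
  tapeEquiv (CN M T x.length x) _ (PCPCoins.dec (pN M T x.length) (bN M T x.length) (kT M T x) ρ)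

/-- The coins are good. [cite: AroraBarakCC2009, Lemma A.31] -/
def GoodCoins (x ρ : List Bool) : Prop := PCPCoins.Good (pN M T x.length) (bN M T x.length) (kT M T x) ρ

/-! ### Bits of numbers -/

/-- The `b` low-order bits of `v`, least significant first. [folklore] -/
def natBits (b v : ℕ) : List Bool := List.ofFn fun i : Fin b => v.testBit i

/-- `natBits b v` has length `b`. [folklore] -/
@[simp] theorem length_natBits (b v : ℕ) : (natBits b v).length = b := by simp [natBits]

/-- The bits of `v < 2ᵇ` have value `v`. [folklore] -/
theorem bitsToNat_natBits : ∀ (b : ℕ) {v : ℕ}, v < 2 ^ b → bitsToNat (natBits b v) = v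
  | 0, v, hv => by simp [natBits] at hv ⊢; omega
  | b + 1, v, hv => by
    have htail : natBits (b + 1) v = v.testBit 0 :: natBits b (v / 2) := by
      unfold natBits
      rw [List.ofFn_succ]
      congr 1
      exact List.ofFn_inj.2 (funext fun i => by rw [Fin.val_succ, ← Nat.testBit_div_two])
    rw [htail, bitsToNat_cons, bitsToNat_natBits b (by rw [pow_succ] at hv; omega), Nat.testBit_zero]
    rcases Nat.mod_two_eq_zero_or_one v with h | h <;> simp [h] <;> omega

/-- Reading back a bit of `natBits`. [folklore] -/
theorem getD_natBits (b v i : ℕ) (hi : i < b) : (natBits b v).getD i false = v.testBit i := by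
  unfold natBits
  rw [List.getD_eq_getElem _ _ (by simpa using hi)]
  simp

section Coding

variable (n : ℕ)

local notation "p" => pN M T n
local notation "𝔽" => FF M T n
local notation "KK" => KN M T n
local notation "mm" => mN M T n
local notation "DD" => DN M T n

/-- Bits per stored field element: `⌊log₂ p⌋ + 1`. [folklore] -/
def b0 : ℕ := Nat.log 2 (pN M T n) + 1

/-- `p < 2^{b₀}`. [folklore] -/
theorem pN_lt_two_pow_b0 : p < 2 ^ b0 M T n := Nat.lt_pow_succ_log_self (by norm_num) _

/-- `0 < b₀`. [folklore] -/
theorem b0_pos : 0 < b0 M T n := Nat.succ_pos _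

/-- **Reading a field element off a proof**: the value of the `b₀` bits from position `pos`, mod `p`. [folklore] -/
def readF (π : ℕ → Bool) (pos : ℕ) : 𝔽 := ((bitsToNat (List.ofFn fun i : Fin (b0 M T n) => π (pos + i)) : ℕ) : 𝔽)

/-- The stored bits of a field element. [folklore] -/
def bitsF (a : 𝔽) : List Bool := natBits (b0 M T n) a.val

/-- **The index of a vector of field elements** in base `p`. [folklore] -/
def vecIdx {k : ℕ} (w : Fin k → 𝔽) : ℕ := ∑ t : Fin k, (w t).val * p ^ (t : ℕ)

/-- The vector of an index. [folklore] -/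
def vecOfIdx (k N : ℕ) : Fin k → 𝔽 := fun t => ((N / p ^ (t : ℕ) % p : ℕ) : 𝔽)

/-- `vecIdx w < p^k`. [folklore] -/
theorem vecIdx_lt {k : ℕ} (w : Fin k → 𝔽) : vecIdx M T n w < p ^ k := by
  unfold vecIdx
  induction k with
  | zero => simp
  | succ k ih =>
    rw [Fin.sum_univ_castSucc]
    simp only [Fin.val_castSucc, Fin.val_last]
    have h1 := ih (fun t => w (Fin.castSucc t))
    have h2 : (w (Fin.last k)).val ≤ p - 1 := Nat.le_sub_one_of_lt (ZMod.val_lt _)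
    have hp : 1 ≤ p := (pN_prime M T n).one_lt.le
    calc _ < p ^ k + (p - 1) * p ^ k := by
          have := Nat.mul_le_mul_right (p ^ k) h2
          omega
      _ = p ^ (k + 1) := by
          rw [pow_succ]
          zify [hp]
          ring

/-- Digits of `vecIdx w`. [folklore] -/
theorem vecIdx_div_mod {k : ℕ} (w : Fin k → 𝔽) (t : Fin k) : vecIdx M T n w / p ^ (t : ℕ) % p = (w t).val := by
  classical
  unfold vecIdx
  have hp : 0 < p := (pN_prime M T n).pos
  -- split the sum at `t`
  have hsplit : ∑ s : Fin k, (w s).val * p ^ (s : ℕ) =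
      (∑ s ∈ univ.filter (fun s : Fin k => (s : ℕ) < t), (w s).val * p ^ (s : ℕ)) +
        ((w t).val * p ^ (t : ℕ) + ∑ s ∈ univ.filter (fun s : Fin k => (t : ℕ) < s), (w s).val * p ^ (s : ℕ)) := by
    rw [← sum_filter_add_sum_filter_not univ (fun s : Fin k => (s : ℕ) < t)]
    congr 1
    have : univ.filter (fun s : Fin k => ¬ (s : ℕ) < t) = insert t (univ.filter fun s : Fin k => (t : ℕ) < s) := by
      ext s
      simp only [mem_filter, mem_univ, true_and, mem_insert]
      constructor
      · intro h
        rcases Nat.lt_or_ge (t : ℕ) s with h' | h'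
        · exact Or.inr h'
        · exact Or.inl (Fin.ext (by omega))
      · rintro (rfl | h) <;> omega
    rw [this, sum_insert (by simp)]
  -- the low part is `< p^t`, the high part is a multiple of `p^(t+1)`
  have hlow : ∑ s ∈ univ.filter (fun s : Fin k => (s : ℕ) < t), (w s).val * p ^ (s : ℕ) < p ^ (t : ℕ) := by
    have key : ∀ u : ℕ, u ≤ t → ∑ s ∈ univ.filter (fun s : Fin k => (s : ℕ) < u), (w s).val * p ^ (s : ℕ) < p ^ u := by
      intro u
      induction u with
      | zero => intro _; simp
      | succ u ih =>
        intro hu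
        have hsplit' : univ.filter (fun s : Fin k => (s : ℕ) < u + 1) =
            univ.filter (fun s : Fin k => (s : ℕ) < u) ∪ univ.filter (fun s : Fin k => (s : ℕ) = u) := by
          ext s; simp only [mem_filter, mem_univ, true_and, mem_union]; omega
        rw [hsplit', sum_union (by
          rw [disjoint_filter]; intro s _ h1 h2; omega)]
        have hone : ∑ s ∈ univ.filter (fun s : Fin k => (s : ℕ) = u), (w s).val * p ^ (s : ℕ) ≤ (p - 1) * p ^ u := by
          have hcard : (univ.filter (fun s : Fin k => (s : ℕ) = u)).card ≤ 1 := by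
            rw [card_le_one]
            intro a ha b hb
            simp only [mem_filter, mem_univ, true_and] at ha hb
            exact Fin.ext (by omega)
          calc _ ≤ ∑ s ∈ univ.filter (fun s : Fin k => (s : ℕ) = u), (p - 1) * p ^ u := by
                refine sum_le_sum fun s hs => ?_
                simp only [mem_filter, mem_univ, true_and] at hs
                rw [hs]
                exact Nat.mul_le_mul_right _ (Nat.le_sub_one_of_lt (ZMod.val_lt _))
            _ ≤ 1 * ((p - 1) * p ^ u) := by
                rw [sum_const, smul_eq_mul]
                exact Nat.mul_le_mul_right _ hcard
            _ = (p - 1) * p ^ u := one_mul _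
        have := ih (by omega)
        calc _ < p ^ u + (p - 1) * p ^ u := by omega
          _ = p ^ (u + 1) := by rw [pow_succ]; zify [(pN_prime M T n).one_lt.le]; ring
    exact key t le_rfl
  have hhigh : ∀ s ∈ univ.filter (fun s : Fin k => (t : ℕ) < s), p ^ ((t : ℕ) + 1) ∣ (w s).val * p ^ (s : ℕ) := by
    intro s hs
    simp only [mem_filter, mem_univ, true_and] at hs
    exact Dvd.dvd.mul_left (pow_dvd_pow p hs) _
  obtain ⟨c, hc⟩ := dvd_sum hhigh
  rw [hsplit, hc]
  have hpt : 0 < p ^ (t : ℕ) := pow_pos hp _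
  rw [show (∑ s ∈ univ.filter (fun s : Fin k => (s : ℕ) < t), (w s).val * p ^ (s : ℕ)) +
      ((w t).val * p ^ (t : ℕ) + p ^ ((t : ℕ) + 1) * c) =
      (∑ s ∈ univ.filter (fun s : Fin k => (s : ℕ) < t), (w s).val * p ^ (s : ℕ)) + p ^ (t : ℕ) * ((w t).val + p * c) by ring,
    Nat.add_mul_div_left _ _ hpt, Nat.div_eq_of_lt hlow, zero_add, Nat.add_mul_mod_self_left,
    Nat.mod_eq_of_lt (ZMod.val_lt _)]

/-- **Decoding the index of a vector.** [folklore] -/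
theorem vecOfIdx_vecIdx {k : ℕ} (w : Fin k → 𝔽) : vecOfIdx M T n k (vecIdx M T n w) = w := by
  funext t
  unfold vecOfIdx
  rw [vecIdx_div_mod, ZMod.natCast_zmod_val]

/-- `vecIdx` is injective. [folklore] -/
theorem vecIdx_injective (k : ℕ) : Function.Injective (vecIdx M T n (k := k)) := fun w w' h => by
  rw [← vecOfIdx_vecIdx M T n w, ← vecOfIdx_vecIdx M T n w', h]

/-! #### Positions -/

/-- **Position of bit `i` of the oracle value at the point `w`.** [folklore] -/
def posY (w : Fin mm → 𝔽) (i : ℕ) : ℕ := vecIdx M T n w * b0 M T n + i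

/-- The start of the message region. [folklore] -/
def baseS : ℕ := p ^ mm * b0 M T n

/-- The index of a challenge prefix (padded to `K` entries). [folklore] -/
def prefVec (pref : List 𝔽) : Fin KK → 𝔽 := fun t => pref.getD t 0

/-- **The index of a message argument** `(ρ, λ, pref)`. [folklore] -/
def sIdx (ρ : Fin KK → 𝔽) (seed : 𝔽) (pref : List 𝔽) : ℕ :=
  ((vecIdx M T n ρ * p + seed.val) * (KK + 1) + pref.length) * p ^ KK + vecIdx M T n (prefVec M T n pref)

/-- **Position of bit `i` of coefficient `j` of the message at `(ρ, λ, pref)`.** [folklore] -/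
def posS (ρ : Fin KK → 𝔽) (seed : 𝔽) (pref : List 𝔽) (j i : ℕ) : ℕ :=
  baseS M T n + (sIdx M T n ρ seed pref * (DD + 1) + j) * b0 M T n + i

/-- Oracle positions lie below the message region. [folklore] -/
theorem posY_lt (w : Fin mm → 𝔽) {i : ℕ} (hi : i < b0 M T n) : posY M T n w i < baseS M T n := by
  unfold posY baseS
  have := vecIdx_lt M T n w
  calc _ < vecIdx M T n w * b0 M T n + b0 M T n := by omega
    _ = (vecIdx M T n w + 1) * b0 M T n := by ring
    _ ≤ _ := Nat.mul_le_mul_right _ this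

/-! #### Decoding a proof table -/

variable {n}

/-- The message read off a table at `(ρ, λ, pref)`: the polynomial of the `D + 1` coded coefficients. [folklore] -/
def msgOf (π : ℕ → Bool) (ρ : Fin KK → 𝔽) (seed : 𝔽) (pref : List 𝔽) : 𝔽[X] :=
  ∑ j ∈ range (DD + 1), Polynomial.C (readF M T n π (posS M T n ρ seed pref j 0)) * Polynomial.X ^ j

/-- **The proof read off a table** `π : ℕ → Bool`. [cite: BabaiFortnowLund1991, §4–§5] -/
def proofOf (N : ℕ) (π : ℕ → Bool) : Proof 𝔽 KK mm N :=
  ⟨fun w => readF M T n π (posY M T n w 0), msgOf M T π⟩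

/-- The oracle of the decoded proof. [folklore] -/
theorem proofOf_Y (N : ℕ) (π : ℕ → Bool) (w : Fin mm → 𝔽) : (proofOf M T (n := n) N π).Y w = readF M T n π (posY M T n w 0) := rfl


/-- **The table of a proof**: the oracle values, then the message coefficients, `b₀` bits each. [folklore] -/
def encodeProof {N : ℕ} (P : Proof 𝔽 KK mm N) (k : ℕ) : Bool :=
  if k < baseS M T n then
    (bitsF M T n (P.Y (vecOfIdx M T n mm (k / b0 M T n)))).getD (k % b0 M T n) false
  else
    let k' := k - baseS M T n
    let q := k' / b0 M T n
    let s := q / (DD + 1)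
    let s₁ := s / p ^ KK
    let s₂ := s₁ / (KK + 1)
    (bitsF M T n ((P.S (vecOfIdx M T n KK (s₂ / p)) ((s₂ % p : ℕ) : 𝔽)
      ((List.ofFn (vecOfIdx M T n KK (s % p ^ KK))).take (s₁ % (KK + 1)))).coeff (q % (DD + 1)))).getD (k' % b0 M T n) false

/-- The table in the message region. [folklore] -/
theorem encodeProof_base_add {N : ℕ} (P : Proof 𝔽 KK mm N) (k' : ℕ) :
    encodeProof M T P (baseS M T n + k') =
      (bitsF M T n ((P.S (vecOfIdx M T n KK (k' / b0 M T n / (DD + 1) / p ^ KK / (KK + 1) / p))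
        ((k' / b0 M T n / (DD + 1) / p ^ KK / (KK + 1) % p : ℕ) : 𝔽)
        ((List.ofFn (vecOfIdx M T n KK (k' / b0 M T n / (DD + 1) % p ^ KK))).take (k' / b0 M T n / (DD + 1) / p ^ KK % (KK + 1)))).coeff
          (k' / b0 M T n % (DD + 1)))).getD (k' % b0 M T n) false := by
  unfold encodeProof
  rw [if_neg (Nat.not_lt.2 (Nat.le_add_right _ _)), Nat.add_sub_cancel_left]

/-- Reading the stored bits of `a` gives `a`. [folklore] -/
theorem readF_of_bits {π : ℕ → Bool} {pos : ℕ} {a : 𝔽} (h : ∀ i, i < b0 M T n → π (pos + i) = (bitsF M T n a).getD i false) :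
    readF M T n π pos = a := by
  unfold readF
  have hl : (List.ofFn fun i : Fin (b0 M T n) => π (pos + i)) = bitsF M T n a := by
    apply List.ext_getElem (by simp [bitsF])
    intro i h1 h2
    simp only [List.getElem_ofFn]
    rw [h i (by simpa using h1), List.getD_eq_getElem]
  rw [hl, bitsF, bitsToNat_natBits _ ((ZMod.val_lt a).trans (pN_lt_two_pow_b0 M T n)), ZMod.natCast_zmod_val]

/-- **The coded oracle is read back exactly.** [folklore] -/
theorem Y_proofOf_encodeProof {N : ℕ} (P : Proof 𝔽 KK mm N) (w : Fin mm → 𝔽) :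
    (proofOf M T (n := n) N (encodeProof M T P)).Y w = P.Y w := by
  rw [proofOf_Y]
  refine readF_of_bits M T fun i hi => ?_
  have hpos : posY M T n w 0 + i = posY M T n w i := by unfold posY; ring
  rw [hpos, encodeProof, if_pos (posY_lt M T n w hi)]
  unfold posY
  have hb := b0_pos M T n
  rw [show vecIdx M T n w * b0 M T n + i = i + vecIdx M T n w * b0 M T n by ring, Nat.add_mul_div_right _ _ hb,
    Nat.div_eq_of_lt hi, zero_add, vecOfIdx_vecIdx, Nat.add_mul_mod_self_right, Nat.mod_eq_of_lt hi]

/-- The padded prefix read back. [folklore] -/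
theorem take_ofFn_prefVec {pref : List 𝔽} (h : pref.length ≤ KK) : (List.ofFn (prefVec M T n pref)).take pref.length = pref := by
  apply List.ext_getElem
  · simp [h]
  · intro i h1 h2
    rw [List.getElem_take, List.getElem_ofFn]
    unfold prefVec
    rw [List.getD_eq_getElem _ _ h2]

/-- Decoding the index of a message argument. [folklore] -/
theorem sIdx_decode (ρ : Fin KK → 𝔽) (seed : 𝔽) {pref : List 𝔽} (h : pref.length ≤ KK) :
    sIdx M T n ρ seed pref % p ^ KK = vecIdx M T n (prefVec M T n pref) ∧
    sIdx M T n ρ seed pref / p ^ KK % (KK + 1) = pref.length ∧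
    sIdx M T n ρ seed pref / p ^ KK / (KK + 1) % p = seed.val ∧
    sIdx M T n ρ seed pref / p ^ KK / (KK + 1) / p = vecIdx M T n ρ := by
  have hp : 0 < p := (pN_prime M T n).pos
  have hpK : 0 < p ^ KK := pow_pos hp _
  have hlt := vecIdx_lt M T n (prefVec M T n pref)
  unfold sIdx
  have hdiv : (((vecIdx M T n ρ * p + seed.val) * (KK + 1) + pref.length) * p ^ KK + vecIdx M T n (prefVec M T n pref)) / p ^ KK =
      (vecIdx M T n ρ * p + seed.val) * (KK + 1) + pref.length := by
    rw [show (((vecIdx M T n ρ * p + seed.val) * (KK + 1) + pref.length) * p ^ KK + vecIdx M T n (prefVec M T n pref)) =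
      vecIdx M T n (prefVec M T n pref) + (((vecIdx M T n ρ * p + seed.val) * (KK + 1) + pref.length)) * p ^ KK by ring,
      Nat.add_mul_div_right _ _ hpK, Nat.div_eq_of_lt hlt, zero_add]
  have hq : ((vecIdx M T n ρ * p + seed.val) * (KK + 1) + pref.length) / (KK + 1) = vecIdx M T n ρ * p + seed.val := by
    rw [show (vecIdx M T n ρ * p + seed.val) * (KK + 1) + pref.length = pref.length + (vecIdx M T n ρ * p + seed.val) * (KK + 1) by ring,
      Nat.add_mul_div_right _ _ (Nat.succ_pos _), Nat.div_eq_of_lt (Nat.lt_succ_of_le h), zero_add]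
  refine ⟨?_, ?_, ?_, ?_⟩
  · rw [Nat.mul_add_mod_of_lt hlt]
  · rw [hdiv, show (vecIdx M T n ρ * p + seed.val) * (KK + 1) + pref.length = pref.length + (vecIdx M T n ρ * p + seed.val) * (KK + 1) by ring,
      Nat.add_mul_mod_self_right, Nat.mod_eq_of_lt (Nat.lt_succ_of_le h)]
  · rw [hdiv, hq, show vecIdx M T n ρ * p + seed.val = seed.val + vecIdx M T n ρ * p by ring, Nat.add_mul_mod_self_right,
      Nat.mod_eq_of_lt (ZMod.val_lt _)]
  · rw [hdiv, hq, show vecIdx M T n ρ * p + seed.val = seed.val + vecIdx M T n ρ * p by ring, Nat.add_mul_div_right _ _ hp,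
      Nat.div_eq_of_lt (ZMod.val_lt _), zero_add]

/-- **The coded message coefficients are read back exactly** (prefixes of length `≤ K`, `j ≤ D`). [folklore] -/
theorem coeff_proofOf_encodeProof {N : ℕ} (P : Proof 𝔽 KK mm N) (ρ : Fin KK → 𝔽) (seed : 𝔽) {pref : List 𝔽}
    (hpref : pref.length ≤ KK) {j : ℕ} (hj : j ≤ DD) :
    readF M T n (encodeProof M T P) (posS M T n ρ seed pref j 0) = (P.S ρ seed pref).coeff j := by
  refine readF_of_bits M T fun i hi => ?_
  have hb := b0_pos M T n
  obtain ⟨e1, e2, e3, e4⟩ := sIdx_decode M T ρ seed hpref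
  have hpos : posS M T n ρ seed pref j 0 + i = baseS M T n + (i + (j + sIdx M T n ρ seed pref * (DD + 1)) * b0 M T n) := by
    unfold posS; ring
  have hq : (i + (j + sIdx M T n ρ seed pref * (DD + 1)) * b0 M T n) / b0 M T n = j + sIdx M T n ρ seed pref * (DD + 1) := by
    rw [Nat.add_mul_div_right _ _ hb, Nat.div_eq_of_lt hi, zero_add]
  have hs : (j + sIdx M T n ρ seed pref * (DD + 1)) / (DD + 1) = sIdx M T n ρ seed pref := by
    rw [Nat.add_mul_div_right _ _ (Nat.succ_pos _), Nat.div_eq_of_lt (Nat.lt_succ_of_le hj), zero_add]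
  have hm1 : (i + (j + sIdx M T n ρ seed pref * (DD + 1)) * b0 M T n) % b0 M T n = i := by
    rw [Nat.add_mul_mod_self_right, Nat.mod_eq_of_lt hi]
  have hm2 : (j + sIdx M T n ρ seed pref * (DD + 1)) % (DD + 1) = j := by
    rw [Nat.add_mul_mod_self_right, Nat.mod_eq_of_lt (Nat.lt_succ_of_le hj)]
  rw [hpos, encodeProof_base_add, hq, hs, hm1, hm2, e1, e2, e3, e4, vecOfIdx_vecIdx, vecOfIdx_vecIdx, ZMod.natCast_zmod_val,
    take_ofFn_prefVec M T hpref]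

/-- **The coded messages are read back exactly** when their degree is `≤ D`. [folklore] -/
theorem S_proofOf_encodeProof {N : ℕ} (P : Proof 𝔽 KK mm N) (ρ : Fin KK → 𝔽) (seed : 𝔽) {pref : List 𝔽}
    (hpref : pref.length ≤ KK) (hdeg : (P.S ρ seed pref).natDegree ≤ DD) :
    (proofOf M T (n := n) N (encodeProof M T P)).S ρ seed pref = P.S ρ seed pref := by
  unfold proofOf
  dsimp only
  unfold msgOf
  conv_rhs => rw [(P.S ρ seed pref).as_sum_range' (DD + 1) (Nat.lt_succ_of_le hdeg)]
  refine sum_congr rfl fun j hj => ?_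
  rw [coeff_proofOf_encodeProof M T P ρ seed hpref (Nat.le_of_lt_succ (mem_range.1 hj)), Polynomial.C_mul_X_pow_eq_monomial]

end Coding

/-! ### The verifier -/

section Verifier

variable (x : List Bool)

local notation "n" => x.length
local notation "p" => pN M T x.length
local notation "𝔽" => FF M T x.length
local notation "KK" => KN M T x.length
local notation "mm" => mN M T x.length
local notation "prm" => prmN M T x.length
local notation "CC" => CN M T x.length x
local notation "HH" => HN M T x.length

/-- The oracle points of the low-degree tests, listed. [folklore] -/
def ldtList (τ : Tape 𝔽 CC (TtN M T n)) : List (Fin mm → 𝔽) :=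
  (List.finRange (TtN M T n)).flatMap fun i => (List.range (dN M T n + 2)).map fun j : ℕ => (τ.tests i).1 + ((j : ℕ) : 𝔽) • (τ.tests i).2

/-- The oracle points of the self-corrected reads, listed along the read enumeration. [folklore] -/
def scList (τ : Tape 𝔽 CC (TtN M T n)) : List (Fin mm → 𝔽) :=
  (List.finRange (nQry CC)).flatMap fun q' =>
    (List.finRange (dN M T n + 1)).map fun i =>
      readAddr (((CN M T x.length x).fam ((qryEquiv CC).symm q').1).addr ((qryEquiv CC).symm q').2) τ.r + scNode (F := 𝔽) (dN M T n) i • τ.dirs ((qryEquiv CC).symm q')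

/-- All oracle points read. [folklore] -/
def ptsList (τ : Tape 𝔽 CC (TtN M T n)) : List (Fin mm → 𝔽) := ldtList M T x τ ++ scList M T x τ

/-- The challenge prefixes of the `K` messages read. [folklore] -/
def msgArgs (τ : Tape 𝔽 CC (TtN M T n)) : List (List 𝔽) := (List.range KK).map fun i => (List.ofFn τ.r).take i

/-- The positions of the bits of a list of oracle points. [folklore] -/
def ptQueries (pts : List (Fin mm → 𝔽)) : List ℕ := pts.flatMap fun w => (List.range (b0 M T n)).map (posY M T n w)

/-- The positions of the bits of the messages at the listed prefixes. [folklore] -/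
def msgQueries (τ : Tape 𝔽 CC (TtN M T n)) (args : List (List 𝔽)) : List ℕ :=
  args.flatMap fun pref => (List.range (DN M T n + 1)).flatMap fun j => (List.range (b0 M T n)).map (posS M T n τ.ρ τ.seed pref j)

open scoped Classical in
/-- **The query map**: no queries on bad coins; else the bits of all oracle points and messages read.
[cite: BabaiFortnowLund1991, §5] -/
def queriesOf (ρc : List Bool) : List ℕ :=
  if GoodCoins M T x ρc then
    ptQueries M T x (ptsList M T x (tapeOf M T x ρc)) ++ msgQueries M T x (tapeOf M T x ρc) (msgArgs M T x (tapeOf M T x ρc))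
  else []

/-- The value of `b₀` answer bits from offset `o`. [folklore] -/
def valAt (a : List Bool) (o : ℕ) : 𝔽 := ((bitsToNat ((a.drop o).take (b0 M T n)) : ℕ) : 𝔽)

open scoped Classical in
/-- The oracle rebuilt from the answers: at a listed point, the value of its answer block (first
occurrence); `0` elsewhere. [folklore] -/
def ansY (τ : Tape 𝔽 CC (TtN M T n)) (a : List Bool) (w : Fin mm → 𝔽) : 𝔽 :=
  if w ∈ ptsList M T x τ then valAt M T x a ((ptsList M T x τ).idxOf w * b0 M T n) else 0

open scoped Classical in
/-- The messages rebuilt from the answers: at a listed prefix (with the tape's `ρ`, `λ`), the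
polynomial of its coefficient blocks; `0` elsewhere. [folklore] -/
def ansS (τ : Tape 𝔽 CC (TtN M T n)) (a : List Bool) (ρ : Fin KK → 𝔽) (seed : 𝔽) (pref : List 𝔽) : 𝔽[X] :=
  if ρ = τ.ρ ∧ seed = τ.seed ∧ pref ∈ msgArgs M T x τ then
    ∑ j ∈ range (DN M T n + 1), Polynomial.C (valAt M T x a
      ((ptsList M T x τ).length * b0 M T n + ((msgArgs M T x τ).idxOf pref * (DN M T n + 1) + j) * b0 M T n)) * Polynomial.X ^ j
  else 0

/-- **The proof rebuilt from the answers.** [folklore] -/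
def proofFromAnswers (τ : Tape 𝔽 CC (TtN M T n)) (a : List Bool) : Proof 𝔽 KK mm (CN M T x.length x).N :=
  ⟨ansY M T x τ a, ansS M T x τ a⟩

open scoped Classical in
/-- **The decision map**: accept on bad coins; else run the algebraic verifier on the rebuilt proof.
[cite: BabaiFortnowLund1991, §5] -/
def decideOf (ρc a : List Bool) : Bool :=
  if GoodCoins M T x ρc then decide (Accept HH prm CC (proofFromAnswers M T x (tapeOf M T x ρc) a) (tapeOf M T x ρc)) else true

/-- **The PCP verifier of the machine `M` with time bound `T`.** [cite: BabaiFortnowLund1991, §5] [cite: AroraBarakCC2009, §11.5] -/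
def _root_.Literature.Computability.Complexity.ScaledPCP.verifier' (M : TM2ComputableAux Bool Bool) (T : ℕ → ℕ) : PCPVerifier where
  coins := coinsN M T
  queries x ρc := queriesOf M T x ρc
  decide x ρc a := decideOf M T x ρc a

/-! ### Indexing concatenations of blocks of equal length -/

omit M T x in
/-- Length of a `flatMap` with blocks of constant length. [folklore] -/
theorem length_flatMap_const {α β : Type} {l : List α} {f : α → List β} {c : ℕ} (hc : ∀ a ∈ l, (f a).length = c) :
    (l.flatMap f).length = l.length * c := by
  induction l with
  | nil => simp
  | cons a l ih =>
    rw [List.flatMap_cons, List.length_append, hc a (by simp), ih fun b hb => hc b (by simp [hb]), List.length_cons]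
    ring

omit M T x in
/-- **Indexing a `flatMap` with blocks of constant length**: position `t c + r` is item `r` of block `t`. [folklore] -/
theorem getElem_flatMap_const {α β : Type} {l : List α} {f : α → List β} {c : ℕ} (hc : ∀ a ∈ l, (f a).length = c)
    {t r : ℕ} (ht : t < l.length) (hr : r < c) (h1 : t * c + r < (l.flatMap f).length) (h2 : r < (f l[t]).length) :
    (l.flatMap f)[t * c + r] = (f l[t])[r] := by
  induction l generalizing t with
  | nil => simp at ht
  | cons a l ih =>
    have hca : (f a).length = c := hc a (by simp)
    simp only [List.flatMap_cons]
    rcases t with _ | t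
    · simp only [Nat.zero_mul, zero_add, List.getElem_cons_zero]
      rw [List.getElem_append_left (by rw [hca]; exact hr)]
    · have hidx : (t + 1) * c + r = (f a).length + (t * c + r) := by rw [hca]; ring
      simp only [hidx, List.getElem_cons_succ]
      rw [List.getElem_append_right (by omega)]
      simp only [Nat.add_sub_cancel_left]
      have hl : t < l.length := by simpa using ht
      exact ih (fun b hb => hc b (by simp [hb])) hl
        (by
          have := length_flatMap_const (l := l) (f := f) fun b hb => hc b (by simp [hb])
          rw [this]
          calc t * c + r < t * c + c := by omega
            _ = (t + 1) * c := by ring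
            _ ≤ l.length * c := Nat.mul_le_mul_right _ hl) h2

omit M T x in
/-- A window of a list, elementwise. [folklore] -/
theorem getElem_take_drop {β : Type} (l : List β) (o b i : ℕ) (h : i < ((l.drop o).take b).length) (h' : o + i < l.length) :
    ((l.drop o).take b)[i] = l[o + i] := by
  rw [List.getElem_take, List.getElem_drop]

/-! ### The points read are the listed points -/

variable {x}

/-- A low-degree-test point is listed. [folklore] -/
theorem mem_ldtList_of_mem_ldtPts {τ : Tape 𝔽 CC (TtN M T n)} {w : Fin mm → 𝔽} (hw : w ∈ ldtPts prm CC τ) : w ∈ ldtList M T x τ := by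
  unfold ldtPts at hw
  simp only [mem_biUnion, mem_univ, true_and, mem_image, mem_range, prmN_d] at hw
  obtain ⟨i, j, hj, rfl⟩ := hw
  unfold ldtList
  refine List.mem_flatMap.2 ⟨i, List.mem_finRange i, ?_⟩
  exact List.mem_map.2 ⟨j, List.mem_range.2 hj, rfl⟩

/-- A self-correction point is listed. [folklore] -/
theorem mem_scList_of_mem_scPts {τ : Tape 𝔽 CC (TtN M T n)} {w : Fin mm → 𝔽} (hw : w ∈ scPts prm CC τ) : w ∈ scList M T x τ := by
  unfold scPts at hw
  simp only [mem_biUnion, mem_univ, true_and, mem_image] at hw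
  obtain ⟨q, i, rfl⟩ := hw
  simp only [scList, List.mem_flatMap, List.mem_finRange, true_and, List.mem_map]
  exact ⟨qryEquiv CC q, i, by rw [Equiv.symm_apply_apply]; rfl⟩

/-- Hence every point read is in `ptsList`. [folklore] -/
theorem mem_ptsList {τ : Tape 𝔽 CC (TtN M T n)} {w : Fin mm → 𝔽} (hw : w ∈ ldtPts prm CC τ ∪ scPts prm CC τ) : w ∈ ptsList M T x τ := by
  unfold ptsList
  rcases mem_union.1 hw with h | h
  · exact List.mem_append_left _ (mem_ldtList_of_mem_ldtPts M T h)
  · exact List.mem_append_right _ (mem_scList_of_mem_scPts M T h)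

/-- The challenge prefixes read are listed. [folklore] -/
theorem mem_msgArgs (τ : Tape 𝔽 CC (TtN M T n)) {i : ℕ} (hi : i < KK) : (List.ofFn τ.r).take i ∈ msgArgs M T x τ :=
  List.mem_map.2 ⟨i, List.mem_range.2 hi, rfl⟩

/-! ### Reading the answers -/

/-- Length of the point queries. [folklore] -/
theorem length_ptQueries (pts : List (Fin mm → 𝔽)) : (ptQueries M T x pts).length = pts.length * b0 M T n :=
  length_flatMap_const (c := b0 M T n) fun _ _ => by simp

/-- Length of the message queries of one prefix. [folklore] -/
theorem length_msgBlock (τ : Tape 𝔽 CC (TtN M T n)) (pref : List 𝔽) :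
    ((List.range (DN M T n + 1)).flatMap fun j => (List.range (b0 M T n)).map (posS M T n τ.ρ τ.seed pref j)).length =
      (DN M T n + 1) * b0 M T n := by
  rw [length_flatMap_const (c := b0 M T n) fun _ _ => by simp, List.length_range]

/-- Length of the message queries. [folklore] -/
theorem length_msgQueries (τ : Tape 𝔽 CC (TtN M T n)) (args : List (List 𝔽)) :
    (msgQueries M T x τ args).length = args.length * ((DN M T n + 1) * b0 M T n) :=
  length_flatMap_const fun pref _ => length_msgBlock M T τ pref

/-- **The point queries**: query `t b₀ + i` is bit `i` of point `t`. [folklore] -/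
theorem getElem_ptQueries (pts : List (Fin mm → 𝔽)) {t i : ℕ} (ht : t < pts.length) (hi : i < b0 M T n)
    (h : t * b0 M T n + i < (ptQueries M T x pts).length) :
    (ptQueries M T x pts)[t * b0 M T n + i] = posY M T n pts[t] i := by
  unfold ptQueries
  rw [getElem_flatMap_const (fun _ _ => by simp) ht hi _ (by simpa using hi)]
  simp

/-- **The message queries**: query `u (D+1) b₀ + j b₀ + i` is bit `i` of coefficient `j` of prefix `u`. [folklore] -/
theorem getElem_msgQueries (τ : Tape 𝔽 CC (TtN M T n)) (args : List (List 𝔽)) {u j i : ℕ} (hu : u < args.length)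
    (hj : j < DN M T n + 1) (hi : i < b0 M T n) (h : u * ((DN M T n + 1) * b0 M T n) + (j * b0 M T n + i) < (msgQueries M T x τ args).length) :
    (msgQueries M T x τ args)[u * ((DN M T n + 1) * b0 M T n) + (j * b0 M T n + i)] = posS M T n τ.ρ τ.seed args[u] j i := by
  unfold msgQueries
  have hji : j * b0 M T n + i < (DN M T n + 1) * b0 M T n := by
    calc j * b0 M T n + i < j * b0 M T n + b0 M T n := by omega
      _ = (j + 1) * b0 M T n := by ring
      _ ≤ _ := Nat.mul_le_mul_right _ hj
  rw [getElem_flatMap_const (fun pref _ => length_msgBlock M T τ pref) hu hji _ (by rw [length_msgBlock]; exact hji),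
    getElem_flatMap_const (fun _ _ => by simp) (by simpa using hj) hi _ (by simpa using hi)]
  simp

/-- The value of an answer window is the value read off the table, if the queries in the window are
the bit positions. [folklore] -/
theorem valAt_eq_readF (π : ℕ → Bool) (Q : List ℕ) (o pos : ℕ) (ho : o + b0 M T n ≤ Q.length)
    (hQ : ∀ i (h : i < b0 M T n), Q[o + i]'(by omega) = pos + i) : valAt M T x (Q.map π) o = readF M T n π pos := by
  unfold valAt readF
  congr 2
  apply List.ext_getElem
  · simp only [List.length_take, List.length_drop, List.length_map, List.length_ofFn]
    omega
  · intro i h1 h2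
    have hi : i < b0 M T n := by simpa using h2
    rw [getElem_take_drop _ _ _ _ h1 (by rw [List.length_map]; omega), List.getElem_map, List.getElem_ofFn, hQ i hi]

variable (x)

open scoped Classical in
/-- **The rebuilt proof agrees with the decoded proof on everything the verifier reads.** [folklore] -/
theorem accept_proofFromAnswers_iff (π : ℕ → Bool) (τ : Tape 𝔽 CC (TtN M T n)) :
    Accept HH prm CC (proofFromAnswers M T x τ ((ptQueries M T x (ptsList M T x τ) ++ msgQueries M T x τ (msgArgs M T x τ)).map π)) τ ↔
      Accept HH prm CC (proofOf M T (CN M T x.length x).N π) τ := by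
  set pts := ptsList M T x τ with hpts
  set args := msgArgs M T x τ with hargs
  have hb := b0_pos M T n
  have hlenP := length_ptQueries M T (x := x) pts
  have hlenM := length_msgQueries M T (x := x) τ args
  refine accept_congr HH prm CC (fun w hw => ?_) (fun i hi => ?_)
  · -- oracle values
    have hmem : w ∈ pts := mem_ptsList M T hw
    set t := pts.idxOf w with ht
    have htl : t < pts.length := List.idxOf_lt_length_of_mem hmem
    have hget : pts[t] = w := List.getElem_idxOf htl
    unfold proofFromAnswers proofOf
    dsimp only
    unfold ansY
    rw [if_pos hmem, ← hpts, ← ht]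
    refine valAt_eq_readF M T π _ _ _ ?_ fun i hi => ?_
    · rw [List.length_append, hlenP]
      calc t * b0 M T n + b0 M T n = (t + 1) * b0 M T n := by ring
        _ ≤ pts.length * b0 M T n := Nat.mul_le_mul_right _ htl
        _ ≤ _ := Nat.le_add_right _ _
    · have hlt : t * b0 M T n + i < (ptQueries M T x pts).length := by
        rw [hlenP]
        calc t * b0 M T n + i < (t + 1) * b0 M T n := by rw [add_mul, one_mul]; omega
          _ ≤ _ := Nat.mul_le_mul_right _ htl
      rw [List.getElem_append_left hlt, getElem_ptQueries M T pts htl hi, hget]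
      unfold posY; ring
  · -- messages
    set pref := (List.ofFn τ.r).take i with hpref
    have hmem : pref ∈ args := mem_msgArgs M T τ hi
    set u := args.idxOf pref with hu
    have hul : u < args.length := List.idxOf_lt_length_of_mem hmem
    have hget : args[u] = pref := List.getElem_idxOf hul
    unfold proofFromAnswers proofOf
    dsimp only
    unfold ansS
    rw [if_pos ⟨rfl, rfl, hmem⟩, ← hpts, ← hargs, ← hu]
    unfold msgOf
    refine sum_congr rfl fun j hj => ?_
    have hjD : j < DN M T n + 1 := mem_range.1 hj
    have hv : valAt M T x ((ptQueries M T x pts ++ msgQueries M T x τ args).map π)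
        (pts.length * b0 M T n + (u * (DN M T n + 1) + j) * b0 M T n) = readF M T n π (posS M T n τ.ρ τ.seed pref j 0) := by
      refine valAt_eq_readF M T π _ _ _ ?_ fun i' hi' => ?_
      · rw [List.length_append, hlenP, hlenM]
        have h1 : (u * (DN M T n + 1) + j) * b0 M T n + b0 M T n ≤ args.length * ((DN M T n + 1) * b0 M T n) := by
          calc (u * (DN M T n + 1) + j) * b0 M T n + b0 M T n = (u * (DN M T n + 1) + (j + 1)) * b0 M T n := by ring
            _ ≤ (u * (DN M T n + 1) + (DN M T n + 1)) * b0 M T n := Nat.mul_le_mul_right _ (by omega)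
            _ = (u + 1) * ((DN M T n + 1) * b0 M T n) := by ring
            _ ≤ _ := Nat.mul_le_mul_right _ hul
        omega
      · have hidx : pts.length * b0 M T n + (u * (DN M T n + 1) + j) * b0 M T n + i' =
            (ptQueries M T x pts).length + (u * ((DN M T n + 1) * b0 M T n) + (j * b0 M T n + i')) := by rw [hlenP]; ring
        have hlt : u * ((DN M T n + 1) * b0 M T n) + (j * b0 M T n + i') < (msgQueries M T x τ args).length := by
          rw [hlenM]
          calc _ < u * ((DN M T n + 1) * b0 M T n) + (j * b0 M T n + b0 M T n) := by omega
            _ = u * ((DN M T n + 1) * b0 M T n) + (j + 1) * b0 M T n := by ring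
            _ ≤ u * ((DN M T n + 1) * b0 M T n) + (DN M T n + 1) * b0 M T n := Nat.add_le_add_left (Nat.mul_le_mul_right _ hjD) _
            _ = (u + 1) * ((DN M T n + 1) * b0 M T n) := by ring
            _ ≤ _ := Nat.mul_le_mul_right _ hul
        simp only [hidx]
        rw [List.getElem_append_right (by omega)]
        simp only [Nat.add_sub_cancel_left]
        rw [getElem_msgQueries M T τ args hul hjD hi' hlt, hget]
        unfold posS; ring
    rw [hv]

open scoped Classical in
/-- **What the verifier accepts**: on bad coins everything; on good coins exactly when the algebraic
verifier accepts the decoded proof on the decoded tape. [cite: BabaiFortnowLund1991, §5] -/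
theorem accepts_iff (π : ℕ → Bool) (ρc : List Bool) :
    (verifier' M T).accepts x π ρc = true ↔
      (¬ GoodCoins M T x ρc ∨ Accept HH prm CC (proofOf M T (CN M T x.length x).N π) (tapeOf M T x ρc)) := by
  unfold PCPVerifier.accepts verifier'
  simp only
  unfold decideOf queriesOf
  by_cases hg : GoodCoins M T x ρc
  · rw [if_pos hg, if_pos hg, decide_eq_true_iff, accept_proofFromAnswers_iff]
    simp [hg]
  · simp [hg]

/-! ### The parameter inequalities -/

/-- `h < p`. [folklore] -/
theorem hN_lt_pN : hN M n < p := by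
  have h1 : hN M n ≤ BN M T n := by unfold BN; omega
  exact h1.trans_lt (BN_lt_pN M T n)

/-- `|Val| ≤ h`. [folklore] -/
theorem card_val_le_hN : Nat.card (Val M.tm) ≤ hN M n := by
  have := card_val_le_cQ M
  unfold hN; omega

/-- `0 < h`. [folklore] -/
theorem hN_pos : 0 < hN M n := by unfold hN; omega

/-- Casting `ℕ → ZMod p` is injective below `h`. [folklore] -/
theorem cast_inj_hN : ∀ a b : ℕ, a < hN M n → b < hN M n → (a : 𝔽) = b → a = b := by
  intro a b ha hb hab
  have hh := hN_lt_pN M T (x := x)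
  have ha' : a < p := lt_trans ha hh
  have hb' : b < p := lt_trans hb hh
  have := congrArg ZMod.val hab
  rwa [ZMod.val_natCast, ZMod.val_natCast, Nat.mod_eq_of_lt ha', Nat.mod_eq_of_lt hb'] at this

/-- `#H = h`. [folklore] -/
theorem card_HN : (HH).card = hN M n := by
  unfold HN nodes
  rw [card_image_of_injOn, card_range]
  intro a ha b hb hab
  exact cast_inj_hN M T (x := x) a b (mem_range.1 (mem_coe.1 ha)) (mem_range.1 (mem_coe.1 hb)) hab

/-- `1 ≤ m`. [folklore] -/
theorem one_le_mN : 1 ≤ mm := by unfold mN mPt; omega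

/-- `1 ≤ d`. [folklore] -/
theorem one_le_dN : 1 ≤ dN M T n := by
  unfold dN
  have h1 := one_le_mN M T (x := x)
  have h2 := two_le_hN M n
  calc 1 = 1 * 1 := rfl
    _ ≤ mN M T n * (hN M n - 1) := Nat.mul_le_mul h1 (by omega)

/-- `m (#H - 1) ≤ d` (equality). [folklore] -/
theorem hd_le : mm * ((HH).card - 1) ≤ (prmN M T n).d := by
  rw [card_HN M T (x := x)]; rfl

/-- `maxDeg · d + (#H - 1) ≤ D`. [folklore] -/
theorem hD_le : (CC).maxDeg * (prmN M T n).d + ((HH).card - 1) ≤ (prmN M T n).D := by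
  rw [card_HN M T (x := x), prmN_d, prmN_D]
  unfold DN
  exact Nat.add_le_add_right (Nat.mul_le_mul_right _ (maxDeg_tableauCSP_le M)) _

/-- `d + 1 < p`. [folklore] -/
theorem dN_succ_lt_pN : dN M T n + 1 < p := by
  have h1 : dN M T n + 1 ≤ BN M T n := by
    unfold BN
    have := two_le_hN M n
    omega
  exact h1.trans_lt (BN_lt_pN M T n)

/-- `1, …, d + 1` are nonzero in `ZMod p`. [folklore] -/
theorem hunit_dN : ∀ i : ℕ, 1 ≤ i → i ≤ dN M T n + 1 → (i : 𝔽) ≠ 0 := by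
  intro i h1 h2 h0
  rw [ZMod.natCast_eq_zero_iff] at h0
  have := Nat.le_of_dvd (by omega) h0
  have := dN_succ_lt_pN M T (x := x)
  omega

/-- The CSP is well formed on `H`. [folklore] -/
theorem wf_CN : (CC).WF HH := wf_tableauCSP M (hN_pos M x) (card_val_le_hN M x)

/-- **A satisfying assignment of the clauses gives a satisfying table.** [folklore] -/
theorem satisfies_Y0_CN {τ : TVar M → Bool} (hτ : ∀ cl ∈ Tableau.clauses M 0 (T n) x, HClause.Holds τ cl) :
    (CC).Satisfies HH (Y0 M (LN M T n) x 0 (T n) τ) :=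
  satisfies_Y0 M (cast_inj_hN M T (x := x)) (hN_pos M x) (card_val_le_hN M x) (T_lt_pow M T n) (S1_lt_pow M T n) τ hτ

/-- **The run decides satisfiability of the CSP.** [folklore] -/
theorem satisfiable_CN_iff {f : List Bool → Bool} (hrun : M.OutputsWithin (boolPair x []) [f (boolPair x [])] (T n)) :
    (CC).Satisfiable HH ↔ f (boolPair x []) = true := by
  have h := satisfiable_tableauCSP_iff_exists M (F := 𝔽) (L := LN M T n) (P := 0) (T := T n) (x := x)
    (cast_inj_hN M T (x := x)) (hN_pos M x) (card_val_le_hN M x)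
    (T_lt_pow M T n) (S1_lt_pow M T n) (f := f) (fun u hu => by rw [List.length_eq_zero_iff.1 (Nat.le_zero.1 hu)]; exact hrun)
  refine (show (CC).Satisfiable HH ↔ ∃ u : List Bool, u.length ≤ 0 ∧ f (boolPair x u) = true from h).trans ⟨?_, fun hf => ⟨[], le_rfl, hf⟩⟩
  rintro ⟨u, hu, hf⟩
  rwa [List.length_eq_zero_iff.1 (Nat.le_zero.1 hu)] at hf

/-! ### Completeness -/

/-- **The honest proof table of `x`**: the code of the honest proof of the intended table of the run.
[cite: BabaiFortnowLund1991, §5] -/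
def honestTable : ℕ → Bool :=
  encodeProof M T (honestProof HH prm CC (Y0 M (LN M T n) x 0 (T n) (Tableau.intended (M := M) x 0 (T n) []))
    (hd_le M T x) (one_le_dN M T (x := x)) (hD_le M T x))

/-- **Completeness.** If the run of `M` on `⟨x, ε⟩` halts within `T |x|` steps with output `[⊤]`,
the honest proof table is accepted with probability `1`. [cite: BabaiFortnowLund1991, §5 (completeness)]
[cite: AroraBarakCC2009, §11.5] -/
theorem completeness {f : List Bool → Bool} (hrun : M.OutputsWithin (boolPair x []) [f (boolPair x [])] (T n))
    (hf : f (boolPair x []) = true) : (verifier' M T).acceptProb x (honestTable M T x) = 1 := by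
  have hsat := satisfies_Y0_CN M T x (Tableau.complete (M := M) (u := []) (P := 0) le_rfl hrun hf)
  have hacc : ∀ τ, Accept HH prm CC (proofOf M T (CN M T x.length x).N (honestTable M T x)) τ := by
    intro τ
    unfold honestTable
    rw [accept_congr HH prm CC (π' := honestProof HH prm CC _ (hd_le M T x) (one_le_dN M T (x := x)) (hD_le M T x))
      (fun w _ => Y_proofOf_encodeProof M T _ w) (fun i hi => S_proofOf_encodeProof M T _ _ _ (by simp)
        (natDegree_honestProof_le HH prm CC _ _ _ _ _ _ _))]
    exact accept_honestProof HH prm CC (wf_CN M T x) hsat _ _ _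
      (fun i h1 h2 => hunit_dN M T (x := x) i h1 (by simp only [prmN_d] at h2; omega)) τ
  unfold PCPVerifier.acceptProb
  rw [uniformProb_eq_cnt_div, cnt_eq_two_pow_of_forall fun ρc _ => ?_]
  · rw [Nat.cast_pow, Nat.cast_ofNat, div_self (by positivity)]
  · show (verifier' M T).accepts x (honestTable M T x) ρc = true
    rw [accepts_iff]
    exact Or.inr (hacc _)

/-! ### Soundness: the numerical bounds -/

/-- The number of families is `NN'`. [folklore] -/
theorem N_CN : (CC).N = NN' M T n := by
  show (xFams (F := 𝔽) M (LN M T n) x ++ nFams M (LN M T n) x.length 0 (T n)).length = _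
  unfold NN'
  rw [List.length_append, length_nFams_eq M (F := 𝔽) (F' := ℚ) (P := 0) (LN M T n) (LN M T n) n n (T n) (T n)]
  congr 1
  unfold xFams
  rw [length_flatMap_const (c := 2) fun _ _ => rfl, List.length_zipIdx]
  ring

/-- The number of reads is `2n + c_Q`. [folklore] -/
theorem card_qry : Fintype.card (CC).Qry = 2 * n + cQ M := by
  rw [show Fintype.card (CC).Qry = nQry CC by unfold nQry; simp [CSP.Qry, Fintype.card_sigma], nQry_CN, sum_arity_nFams_zero]

/-- `8 ·` reads `≤ d`. [folklore] -/
theorem eight_card_qry_le : 8 * Fintype.card (CC).Qry ≤ dN M T n := by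
  rw [card_qry]
  have h1 : hN M n - 1 ≤ dN M T n := by
    unfold dN
    have := one_le_mN M T (x := x)
    calc hN M n - 1 = 1 * (hN M n - 1) := (one_mul _).symm
      _ ≤ _ := Nat.mul_le_mul_right _ this
  unfold hN at h1
  omega

/-- `M₂ = p^m ≥ p`. [folklore] -/
theorem pN_le_cardPts : p ≤ Fintype.card (Fin mm → 𝔽) := by
  rw [Fintype.card_fun, Fintype.card_fin, ZMod.card]
  calc p = p ^ 1 := (pow_one _).symm
    _ ≤ p ^ mm := Nat.pow_le_pow_right (pN_prime M T n).pos (one_le_mN M T (x := x))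

/-- **The coin term**: `kF p / 2ᵇ ≤ 1/16`. [folklore] -/
theorem coin_term_le : ((kF M T n * p : ℕ) : ℝ) / 2 ^ bN M T n ≤ 1 / 16 := by
  have h1 : p < 2 ^ (Nat.log 2 p + 1) := Nat.lt_pow_succ_log_self (by norm_num) _
  have h2 : kF M T n < 2 ^ (Nat.log 2 (kF M T n) + 1) := Nat.lt_pow_succ_log_self (by norm_num) _
  have h3 : 16 * (kF M T n * p) ≤ 2 ^ bN M T n := by
    unfold bN
    rw [show Nat.log 2 p + 1 + (Nat.log 2 (kF M T n) + 5) = (Nat.log 2 p + 1) + (Nat.log 2 (kF M T n) + 1) + 4 by ring,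
      pow_add, pow_add]
    calc 16 * (kF M T n * p) = p * kF M T n * 2 ^ 4 := by ring
      _ ≤ 2 ^ (Nat.log 2 p + 1) * 2 ^ (Nat.log 2 (kF M T n) + 1) * 2 ^ 4 :=
          Nat.mul_le_mul_right _ (Nat.mul_le_mul h1.le h2.le)
  rw [div_le_div_iff₀ (by positivity) (by norm_num), one_mul, mul_comm]
  exact_mod_cast h3

/-- **The field term**: `(K D + K (#H - 1) + (N - 1)) / p ≤ 1/16`. [folklore] -/
theorem field_term_le : ((KK * (prmN M T n).D + KK * ((HH).card - 1) + ((CC).N - 1) : ℕ) : ℝ) / p ≤ 1 / 16 := by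
  have hB := BN_lt_pN M T n
  have h1 : 16 * (KK * (prmN M T n).D + KK * ((HH).card - 1) + ((CC).N - 1)) ≤ p := by
    rw [card_HN M T (x := x), N_CN M T x, prmN_D]
    refine le_trans ?_ hB.le
    unfold BN
    omega
  rw [div_le_div_iff₀ (by exact_mod_cast (pN_prime M T n).pos) (by norm_num), one_mul, mul_comm]
  exact_mod_cast h1

/-- The threshold of the analysis: `θ = ⌊M₂² / ((d+1)(2d+5))⌋`. [folklore] -/
def θN : ℕ := Fintype.card (Fin mm → 𝔽) ^ 2 / ((dN M T n + 1) * (2 * dN M T n + 5))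

/-- `(d+1)(2d+5) θ ≤ M₂²`. [folklore] -/
theorem hθ : (dN M T n + 1) * (2 * dN M T n + 5) * θN M T x ≤ Fintype.card (Fin mm → 𝔽) ^ 2 := Nat.mul_div_le _ _

/-- **The read term**: `2 Q (d+1) θ / M₂² ≤ 1/8`. [folklore] -/
theorem read_term_le : ((2 * Fintype.card (CC).Qry * (dN M T n + 1) * θN M T x : ℕ) : ℝ) /
    ((Fintype.card (Fin mm → 𝔽) : ℝ) * Fintype.card (Fin mm → 𝔽)) ≤ 1 / 8 := by
  set Q := Fintype.card (CC).Qry with hQ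
  set M2 := Fintype.card (Fin mm → 𝔽) with hM2
  set c1 := (dN M T n + 1) * (2 * dN M T n + 5) with hc1
  have hM2pos : 0 < M2 := Fintype.card_pos
  have h8 := eight_card_qry_le M T x
  rw [← hQ] at h8
  have key : 8 * (2 * Q * (dN M T n + 1) * θN M T x) ≤ M2 * M2 := by
    have hc1pos : 0 < c1 := by positivity
    calc 8 * (2 * Q * (dN M T n + 1) * θN M T x) = 16 * Q * (dN M T n + 1) * (M2 ^ 2 / c1) := by rw [θN, ← hM2, ← hc1]; ring
      _ ≤ 16 * Q * (dN M T n + 1) * M2 ^ 2 / c1 := Nat.mul_div_le_mul_div_assoc _ _ _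
      _ ≤ M2 * M2 := by
          refine Nat.div_le_of_le_mul ?_
          rw [hc1, sq]
          calc 16 * Q * (dN M T n + 1) * (M2 * M2) = (16 * Q) * ((dN M T n + 1) * (M2 * M2)) := by ring
            _ ≤ (2 * dN M T n + 5) * ((dN M T n + 1) * (M2 * M2)) := Nat.mul_le_mul_right _ (by omega)
            _ = (dN M T n + 1) * (2 * dN M T n + 5) * (M2 * M2) := by ring
  rw [div_le_div_iff₀ (by positivity) (by norm_num), one_mul, mul_comm]
  exact_mod_cast key

/-- `e⁻² ≤ 1/7`. [folklore] -/
theorem exp_neg_two_le : Real.exp (-2) ≤ 1 / 7 := by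
  have h := Real.exp_one_gt_d9
  rw [Real.exp_neg, inv_eq_one_div, div_le_div_iff₀ (Real.exp_pos _) (by norm_num), one_mul, one_mul,
    show (2 : ℝ) = 1 + 1 by norm_num, Real.exp_add]
  nlinarith [Real.exp_pos 1]

/-- **The test term**: `((M₂² - θ)/M₂²)^{Tt} ≤ 1/7`. [cite: RubinfeldSudan1996, §4] -/
theorem test_term_le : ((((Fintype.card (Fin mm → 𝔽) * Fintype.card (Fin mm → 𝔽) - θN M T x : ℕ) : ℝ) /
    ((Fintype.card (Fin mm → 𝔽) : ℝ) * Fintype.card (Fin mm → 𝔽))) ^ TtN M T n) ≤ 1 / 7 := by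
  set M2 := Fintype.card (Fin mm → 𝔽) with hM2
  set c1 := (dN M T n + 1) * (2 * dN M T n + 5) with hc1
  have hM2pos : 0 < M2 := Fintype.card_pos
  have hc1pos : 0 < c1 := by positivity
  -- `2 c₁ ≤ M₂²`
  have hbig : 2 * c1 ≤ M2 * M2 := by
    have hp := pN_le_cardPts M T x
    rw [← hM2] at hp
    have hd : dN M T n + 1 < p := dN_succ_lt_pN M T (x := x)
    have hB : 2 * dN M T n + 5 ≤ p := by
      have := BN_lt_pN M T n
      have h2 := two_le_hN M n
      unfold BN at this
      omega
    calc 2 * c1 = (2 * (dN M T n + 1)) * (2 * dN M T n + 5) := by rw [hc1]; ring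
      _ ≤ p * p := Nat.mul_le_mul (by omega) hB
      _ ≤ M2 * M2 := Nat.mul_le_mul hp hp
  -- the base is `≤ 1 - 1/(2 c₁)`
  have hθlow : M2 * M2 ≤ 2 * c1 * θN M T x := by
    have hlt := Nat.lt_mul_div_succ (M2 ^ 2) hc1pos
    rw [show θN M T x = M2 ^ 2 / c1 from rfl]
    rw [sq] at hlt ⊢
    nlinarith
  have hsub : θN M T x ≤ M2 * M2 := by
    rw [show θN M T x = M2 ^ 2 / c1 from rfl, sq]
    exact Nat.div_le_self _ _
  have hbase : ((M2 * M2 - θN M T x : ℕ) : ℝ) / ((M2 : ℝ) * M2) ≤ 1 - 1 / (2 * c1) := by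
    rw [div_le_iff₀ (by positivity), Nat.cast_sub hsub]
    have h' : ((M2 * M2 : ℕ) : ℝ) ≤ ((2 * c1 * θN M T x : ℕ) : ℝ) := by exact_mod_cast hθlow
    push_cast at h' ⊢
    have hc1R : (0 : ℝ) < c1 := by exact_mod_cast hc1pos
    field_simp
    nlinarith
  have hbase0 : (0 : ℝ) ≤ ((M2 * M2 - θN M T x : ℕ) : ℝ) / ((M2 : ℝ) * M2) := by positivity
  -- `(1 - 1/(2c₁))^{4 c₁} ≤ e⁻²`
  have hexp : (1 - 1 / (2 * (c1 : ℝ))) ^ TtN M T n ≤ Real.exp (-2) := by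
    have hT : TtN M T n = 4 * c1 := by rw [hc1]; rfl
    rw [hT]
    have h := Real.one_sub_div_pow_le_exp_neg (t := 2) (show (2 : ℝ) ≤ ((4 * c1 : ℕ) : ℝ) by
      have : (1 : ℝ) ≤ c1 := by exact_mod_cast hc1pos
      push_cast; linarith)
    have heq : (1 : ℝ) - 1 / (2 * (c1 : ℝ)) = 1 - 2 / ((4 * c1 : ℕ) : ℝ) := by
      have hc1R : (0 : ℝ) < c1 := by exact_mod_cast hc1pos
      push_cast
      field_simp
      ring
    rw [heq]
    exact h
  calc _ ≤ (1 - 1 / (2 * (c1 : ℝ))) ^ TtN M T n := pow_le_pow_left₀ hbase0 hbase _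
    _ ≤ Real.exp (-2) := hexp
    _ ≤ 1 / 7 := exp_neg_two_le

/-! ### Soundness -/

open scoped Classical in
/-- The accepting vectors of a proof table. [folklore] -/
def accVecs (πb : ℕ → Bool) : Finset (Fin (kT M T x) → 𝔽) :=
  univ.filter fun v => Accept HH prm CC (proofOf M T (CN M T x.length x).N πb) (tapeEquiv CC (TtN M T n) v)

open scoped Classical in
/-- **The acceptance event through the coins.** [folklore] -/
theorem accepts_setOf_eq (πb : ℕ → Bool) :
    {ρc | (verifier' M T).accepts x πb ρc = true} =
      {ρc | ¬ PCPCoins.Good p (bN M T n) (kT M T x) ρc ∨ PCPCoins.dec p (bN M T n) (kT M T x) ρc ∈ accVecs M T x πb} := by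
  ext ρc
  rw [Set.mem_setOf_eq, Set.mem_setOf_eq, accepts_iff]
  unfold accVecs GoodCoins tapeOf
  rw [mem_filter]
  simp only [mem_univ, true_and]

open scoped Classical in
/-- **The accepting vectors are as many as the accepting tapes.** [folklore] -/
theorem card_accVecs (πb : ℕ → Bool) :
    (accVecs M T x πb).card = (univ.filter fun τ : Tape 𝔽 CC (TtN M T n) => Accept HH prm CC (proofOf M T (CN M T x.length x).N πb) τ).card := by
  refine card_equiv (tapeEquiv CC (TtN M T n)) fun v => ?_
  unfold accVecs
  simp only [mem_filter, mem_univ, true_and]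

/-- The tape space has `p^{kT}` elements. [folklore] -/
theorem card_tape' : Fintype.card (Tape 𝔽 CC (TtN M T n)) = p ^ kT M T x := by
  rw [← Fintype.card_congr (tapeEquiv CC (TtN M T n)), Fintype.card_fun, Fintype.card_fin, ZMod.card]

open scoped Classical in
/-- **The algebraic count, for the accepting vectors**: `#acc / p^{kT} ≤ 1/7 + 1/8 + 1/16` when the
CSP is unsatisfiable. [cite: BabaiFortnowLund1991, §5–§7 (soundness)] -/
theorem card_accVecs_div_le (hC : ¬ (CC).Satisfiable HH) (πb : ℕ → Bool) :
    ((accVecs M T x πb).card : ℝ) / (p : ℝ) ^ kT M T x ≤ 1 / 7 + 1 / 8 + 1 / 16 := by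
  have hppos : (0 : ℝ) < (p : ℝ) ^ kT M T x := by
    have := (pN_prime M T n).pos
    positivity
  rw [div_le_iff₀ hppos, card_accVecs]
  refine (AlgebraicPCP.soundness HH prm CC hC (proofOf M T (CN M T x.length x).N πb) (one_le_dN M T (x := x)) (hD_le M T x)
    (hunit_dN M T (x := x)) (θ := θN M T x) (hθ M T x)).trans ?_
  have hct : (Fintype.card (Tape 𝔽 CC (prmN M T n).T) : ℝ) = (p : ℝ) ^ kT M T x := by
    rw [show (prmN M T n).T = TtN M T n from rfl, card_tape' M T x]; push_cast; ring
  rw [hct]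
  refine mul_le_mul_of_nonneg_right ?_ hppos.le
  exact add_le_add (add_le_add (test_term_le M T x) (read_term_le M T x)) (field_term_le M T x)

/-- **Soundness.** If the run of `M` on `⟨x, ε⟩` halts within `T |x|` steps with output `[⊥]`, every
proof table is accepted with probability `≤ 1/2`: bad coins `≤ 1/16` (`PCPCoins`), and on good coins
the tape is uniform, so the soundness count of `AlgebraicPCPSoundness` applies to the decoded proof
against the UNSATISFIABLE tableau CSP: `≤ 1/7 + 1/8 + 1/16`. [cite: BabaiFortnowLund1991, §5–§7 (soundness)]
[cite: AroraBarakCC2009, §11.5] -/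
theorem soundness {f : List Bool → Bool} (hrun : M.OutputsWithin (boolPair x []) [f (boolPair x [])] (T n))
    (hf : f (boolPair x []) = false) (πb : ℕ → Bool) : (verifier' M T).acceptProb x πb ≤ 1 / 2 := by
  have hC : ¬ (CC).Satisfiable HH := by
    rw [satisfiable_CN_iff M T x hrun, hf]
    exact Bool.false_ne_true
  have hprob : (verifier' M T).acceptProb x πb =
      uniformProb (kT M T x * bN M T n) {ρc | ¬ PCPCoins.Good p (bN M T n) (kT M T x) ρc ∨
        PCPCoins.dec p (bN M T n) (kT M T x) ρc ∈ accVecs M T x πb} := by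
    unfold PCPVerifier.acceptProb
    rw [accepts_setOf_eq, show (verifier' M T).coins x.length = kT M T x * bN M T n from by
      show coinsN M T n = _; unfold coinsN; rw [kF_eq M T x]]
  rw [hprob]
  refine (@PCPCoins.uniformProb_bad_or_dec_le (pN M T x.length) (bN M T n) _ (kT M T x) (accVecs M T x πb)).trans ?_
  have hAle := card_accVecs_div_le M T x hC πb
  have hcoin : (kT M T x : ℝ) * p / 2 ^ bN M T n ≤ 1 / 16 := by
    have := coin_term_le M T x
    rw [kF_eq M T x] at this
    push_cast at this
    exact this
  calc _ ≤ (1 : ℝ) / 16 + (1 / 7 + 1 / 8 + 1 / 16) := add_le_add hcoin hAle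
    _ ≤ 1 / 2 := by norm_num

end Verifier

end ScaledPCP

end Literature.Computability.Complexity

end
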